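import Mathlib
import Summits.Ventures.HodgeRepro.Tier4.Line1.RTFSetting
import Summits.Ventures.HodgeRepro.Tier4.Line1.RtfUnfold
import Summits.Ventures.HodgeRepro.Tier4.Line1.RtfSpectralStep
import Summits.Ventures.HodgeRepro.Tier4.Line1.KernelSupportFinite
import Summits.Ventures.HodgeRepro.Tier4.Line1.KernelUnfold
import Summits.Ventures.HodgeRepro.Tier4.Line1.KernelOperator
import Summits.Ventures.HodgeRepro.Tier4.Line1.KernelOpEqR
import Summits.Ventures.HodgeRepro.Tier4.Line1.KernelEigen
import Summits.Ventures.HodgeRepro.Tier4.Line1.KernelCompact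
import Summits.Ventures.HodgeRepro.Tier4.Line1.InnerCalculus
import Summits.Ventures.HodgeRepro.Tier4.Line1.KernelAdjoint
import Summits.Ventures.HodgeRepro.Tier4.Line1.RelClosed

/-!
# Tier4/Line1/RelClosedOrtho — LINE L1, towards J1-(4b): the orthogonal complement and the classes of a subspace

Blind re-derivation cell `pub-hodge-repro`, Tier 4 «prove the step» (README §9–§10), seat t4-L1-p4 (prover, gen 0;
J1-(4b) `exists_irreducible_invariant_subspace` (Skeleton v0.16 L444, the declared wall) as census + rungs, S12549;
after `InnerCalculus` and `KernelAdjoint`).  Generic Part I over every `RTF.Setting G`, `[SecondCountableTopology G]`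
where the `L²(DG)` Hilbert-space arguments need it; Mathlib + the landed L1 layer only.  Paper: proofs/t4/L1/J1-4b.md.

This module (2 of 4): `inner_add_left'` / `inner_smul_left'` / `inner_sub_left'` (linearity of `S.inner`); L2
`relClosed_ortho` (`{ψ ∈ U | ψ ⊥ V'}` is relatively closed invariant: right translation by R-B, `R(f)` by the adjoint
identity R-C, closedness by Cauchy–Schwarz); `cls` (the `L²(DG)`-classes of a relatively closed invariant subspace),
`mem_cls_iff`, `cls_mono`, `toLp_mem_cls`.

Nothing here says anything about the status of the Hodge conjecture for CM abelian varieties, which is NOT proved;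
HC_CM is NOT proved by anyone in this repository.
-/

set_option autoImplicit false

noncomputable section

namespace Summit.Ventures.HodgeRepro.Tier4.Line1

open MeasureTheory Topology Filter Set
open scoped Uniformity Pointwise InnerProductSpace ComplexConjugate

namespace RTF

variable {G : Type} [Group G] [TopologicalSpace G] [IsTopologicalGroup G] [MeasurableSpace G]
  [BorelSpace G]

namespace Setting

variable (S : Setting G)


omit [IsTopologicalGroup G] in
/-- `S.inner` is additive in the first argument on continuous functions. -/
theorem inner_add_left' {ψ ψ' φ : G → ℂ} (hψ : Continuous ψ) (hψ' : Continuous ψ') (hφ : Continuous φ) :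
    S.inner (fun x => ψ x + ψ' x) φ = S.inner ψ φ + S.inner ψ' φ := by
  have hc : Continuous fun x => ψ x + ψ' x := hψ.add hψ'
  rw [S.inner_eq_L2 hc hφ, S.inner_eq_L2 hψ hφ, S.inner_eq_L2 hψ' hφ, S.toLp_add' hψ hψ',
    inner_add_right]

omit [IsTopologicalGroup G] in
/-- `S.inner` is homogeneous in the first argument on continuous functions. -/
theorem inner_smul_left' {ψ φ : G → ℂ} (hψ : Continuous ψ) (hφ : Continuous φ) (c : ℂ) :
    S.inner (fun x => c * ψ x) φ = c * S.inner ψ φ := by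
  have hc : Continuous fun x => c * ψ x := continuous_const.mul hψ
  rw [S.inner_eq_L2 hc hφ, S.inner_eq_L2 hψ hφ, S.toLp_smul' hψ c, inner_smul_right]

omit [IsTopologicalGroup G] in
/-- `S.inner` is subtractive in the first argument on continuous functions. -/
theorem inner_sub_left' {ψ ψ' φ : G → ℂ} (hψ : Continuous ψ) (hψ' : Continuous ψ') (hφ : Continuous φ) :
    S.inner (fun x => ψ x - ψ' x) φ = S.inner ψ φ - S.inner ψ' φ := by
  have e : (fun x => ψ x - ψ' x) = fun x => ψ x + (-1 : ℂ) * ψ' x := by ext x; ring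
  have hc : Continuous fun x => (-1 : ℂ) * ψ' x := continuous_const.mul hψ'
  rw [e, S.inner_add_left' hψ hc hφ, S.inner_smul_left' hψ' hφ]
  ring

/-- L2: the orthogonal complement `U₂ := {ψ ∈ U | ∀ φ ∈ V', ⟨ψ, φ⟩ = 0}` of an invariant `V'` inside a
relatively closed invariant `U` is a relatively closed invariant subspace of `V` (right translation by
R-B, `R(f)` by the adjoint identity R-C, closedness by Cauchy–Schwarz). -/
theorem relClosed_ortho [SecondCountableTopology G] {V U : Set (G → ℂ)} (hU : S.RelClosed V U)
    {V' : Set (G → ℂ)} (hV' : S.IsInvariantSubspace V') :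
    S.RelClosed V {ψ | ψ ∈ U ∧ ∀ φ ∈ V', S.inner ψ φ = 0} := by
  haveI : Countable S.Gk := S.countable_Gk
  refine ⟨fun ψ hψ => hU.subset hψ.1, ?_, ?_, ?_⟩
  · refine ⟨fun ψ hψ => hU.inv.inv ψ hψ.1, fun ψ hψ => hU.inv.cont ψ hψ.1, ?_, ?_, ?_, ?_⟩
    · -- right translation
      rintro ψ ⟨hψU, horth⟩ g
      refine ⟨hU.inv.right ψ hψU g, fun φ hφ => ?_⟩
      have h1 := S.inner_rightTranslate (hU.inv.inv ψ hψU) (hV'.inv _ (hV'.right φ hφ g⁻¹)) g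
      have e : (fun x => (fun y => φ (y * g⁻¹)) (x * g)) = φ := by
        ext x
        simp only [mul_inv_cancel_right]
      rw [e] at h1
      rw [h1]
      exact horth _ (hV'.right φ hφ g⁻¹)
    · -- addition
      rintro ψ ⟨hψU, horth⟩ ψ' ⟨hψ'U, horth'⟩
      refine ⟨hU.inv.add ψ hψU ψ' hψ'U, fun φ hφ => ?_⟩
      rw [S.inner_add_left' (hU.inv.cont ψ hψU) (hU.inv.cont ψ' hψ'U) (hV'.cont φ hφ), horth φ hφ,
        horth' φ hφ, add_zero]
    · -- scalar multiplication
      rintro ψ ⟨hψU, horth⟩ c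
      refine ⟨hU.inv.smul ψ hψU c, fun φ hφ => ?_⟩
      rw [S.inner_smul_left' (hU.inv.cont ψ hψU) (hV'.cont φ hφ), horth φ hφ, mul_zero]
    · -- `R(f)`
      rintro ψ ⟨hψU, horth⟩ f hf
      refine ⟨hU.inv.conv ψ hψU f hf, fun φ hφ => ?_⟩
      rw [S.inner_R_eq_inner_R_adj hf (hU.inv.inv ψ hψU) (hU.inv.cont ψ hψU) (hV'.inv φ hφ)
        (hV'.cont φ hφ)]
      exact horth _ (hV'.conv φ hφ _ hf.refl.cj)
  · refine ⟨hU.zero_mem, fun φ hφ => ?_⟩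
    unfold inner
    simp
  · -- closedness: `⟨ψ, φ⟩` is the limit of `⟨ψₙ, φ⟩ = 0` (Cauchy–Schwarz)
    intro ψ hψc hψinv happ
    refine ⟨hU.closed ψ hψc hψinv fun ε hε => ?_, fun φ hφ => ?_⟩
    · obtain ⟨ψ', ⟨hψ'U, -⟩, hlt⟩ := happ ε hε
      exact ⟨ψ', hψ'U, hlt⟩
    · have hφc := hV'.cont φ hφ
      by_contra hne
      have hpos : 0 < ‖S.inner ψ φ‖ := norm_pos_iff.mpr hne
      set N : ℝ := ‖(S.memLp_two_DG hφc).toLp φ‖ with hN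
      have hN0 : 0 ≤ N := norm_nonneg _
      obtain ⟨ψ', ⟨hψ'U, horth'⟩, hlt⟩ := happ (‖S.inner ψ φ‖ / (N + 1)) (by positivity)
      have hψ'c := hU.inv.cont ψ' hψ'U
      have h1 : S.inner ψ φ = S.inner (fun x => ψ x - ψ' x) φ := by
        rw [S.inner_sub_left' hψc hψ'c hφc, horth' φ hφ, sub_zero]
      have hsc : Continuous fun x => ψ x - ψ' x := hψc.sub hψ'c
      have h2 := S.norm_inner_le hsc hφc
      rw [Lp.norm_toLp] at h2
      have hfin : eLpNorm (fun x => ψ x - ψ' x) 2 (S.μ.restrict S.DG) ≠ ⊤ :=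
        (S.memLp_two_DG (hψc.sub hψ'c)).eLpNorm_lt_top.ne
      rw [← ENNReal.ofReal_toReal hfin, ENNReal.ofReal_lt_ofReal_iff (by positivity)] at hlt
      rw [← h1] at h2
      have h3 : ‖S.inner ψ φ‖ < ‖S.inner ψ φ‖ / (N + 1) * N + ‖S.inner ψ φ‖ / (N + 1) * 1 := by
        calc ‖S.inner ψ φ‖ ≤ (eLpNorm (fun x => ψ x - ψ' x) 2 (S.μ.restrict S.DG)).toReal * N := h2
          _ < ‖S.inner ψ φ‖ / (N + 1) * N + ‖S.inner ψ φ‖ / (N + 1) * 1 := by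
              have := mul_le_mul_of_nonneg_right hlt.le hN0
              have h4 : 0 < ‖S.inner ψ φ‖ / (N + 1) * 1 := by positivity
              linarith
      rw [← mul_add, div_mul_cancel₀ _ (by positivity)] at h3
      exact lt_irrefl _ h3


/-- the `L²(DG)`-classes of a relatively closed invariant subspace. -/
def cls {V U : Set (G → ℂ)} (hU : S.RelClosed V U) : Submodule ℂ (Lp ℂ 2 (S.μ.restrict S.DG)) :=
  S.classes U hU.inv ⟨_, hU.zero_mem⟩

omit [IsTopologicalGroup G] [BorelSpace G] in
/-- membership in `cls`. -/
theorem mem_cls_iff {V U : Set (G → ℂ)} (hU : S.RelClosed V U) (u : Lp ℂ 2 (S.μ.restrict S.DG)) :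
    u ∈ S.cls hU ↔ ∃ ψ ∈ U, ⇑u =ᵐ[S.μ.restrict S.DG] ψ := Iff.rfl

omit [IsTopologicalGroup G] [BorelSpace G] in
/-- `cls` is monotone. -/
theorem cls_mono {V U U' : Set (G → ℂ)} (hU : S.RelClosed V U) (hU' : S.RelClosed V U') (h : U ⊆ U') :
    S.cls hU ≤ S.cls hU' := by
  rintro u ⟨ψ, hψ, hu⟩
  exact ⟨ψ, h hψ, hu⟩

omit [IsTopologicalGroup G] in
/-- the class of a member of `U` lies in `cls`. -/
theorem toLp_mem_cls {V U : Set (G → ℂ)} (hU : S.RelClosed V U) {ψ : G → ℂ} (hψ : ψ ∈ U) :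
    (S.memLp_two_DG (hU.inv.cont ψ hψ)).toLp ψ ∈ S.cls hU :=
  ⟨ψ, hψ, MemLp.coeFn_toLp _⟩

end Setting

end RTF

end Summit.Ventures.HodgeRepro.Tier4.Line1
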